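import Literature.Probability.FitznerVanDerHofstad2017.NoblePhiRemWeighted
import Literature.Probability.FitznerVanDerHofstad2017.NobleFRemL1
import Literature.Probability.FitznerVanDerHofstad2017.NobleFRemWeighted
import HarnessLib

/-!
# The extended simplified form with App. D's three remainder bounds (D.13), (D.21), (D.29) proved — assembly

[NoBLE17] = Fitzner–van der Hofstad, *Generalized approach to the non-backtracking lace expansion*,
PTRF 169 (2017), Prop. 4.5 and App. D.

`NoblePhiRemWeighted.nobleSimplifiedFormF3At_of_assumptions₆` assembles the extended simplified rewrite from
Assumptions 4.1–4.3 with the two named analytic hypotheses (D.13) and (D.29) on the constructed remainder `R_F`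
((D.21) being proved there); `NobleFRemL1.nobleFRem_l1_le_extraOfInputs` proves (D.13) under the decidable side
condition `(2d−1)·i.mub ≤ 2d·i.mu`, and `NobleFRemWeighted.nobleFRem_weighted` proves (D.29) verbatim.  This module
records the corollary with NO named analytic hypothesis left: the extended simplified form
`NobleSimplifiedFormF3At d p (nobleBetaOfInputsCorr d i) (NobleBetaF3.ofFn (extraOfInputsCorr d i))` from the NoBLE
equation at `p`, Assumption 4.1 for the split (automatic for percolation), Assumption 4.3 at `p` with well-formed
constants `i`, the total rotational symmetry of the three shifted `α`-sums (automatic for percolation), the four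
decidable sign conditions (N1′), (N2)–(N4) and the three decidable caps on the record.  Additive: no existing module
is modified.
-/

namespace Literature.Probability.FitznerVanDerHofstad2017

open scoped BigOperators
open Literature.Probability.LatticeModels
open Literature.Probability.Percolation
open Literature.Barriers.CriticalPhenomena

variable {d : ℕ}

section AppDAssembly

local notation "𝐞" => Literature.Probability.Percolation.stepVec

variable {p : unitInterval} {i : BetaMap.Inputs} {S : NobleSplit d p}

variable (hd : 2 ≤ d) (hp : p < criticalProbI d)
include hd hp

/-- **[NoBLE17, Prop. 4.5(ii) / App. D — extended form with (D.13), (D.21), (D.29) PROVED].** As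
`nobleSimplifiedFormF3At_of_assumptions₆` but WITHOUT the hypotheses (D.13) and (D.29): (D.13) is replaced by the
decidable side condition `hcapQ : (2d−1)·i.mub ≤ 2d·i.mu` (under which the `ℓ¹` bookkeeping constant is at most the
wired `betaRF`), (D.29) holds verbatim (`nobleFRem_weighted`).  No named analytic hypothesis remains.
[cite: FitznerVanDerHofstad2016NoBLE, Prop. 4.5 (p. 1088); App. D (D.2), (D.3) (p. 1111), (D.13) (p. 1113), (D.21) (p. 1115), (D.29) (p. 1116)] -/
theorem nobleSimplifiedFormF3At_of_assumptions₈ (hp0 : 0 < (p : ℝ)) (hWF : NobleInputsWF d i)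
    (hE : PercolationNobleEquationAt d p) (h41 : NobleAssumption41At d p S) (h43 : NobleAssumption43At d p S i)
    (hTRS : IsTRS (fun x => ∑ ι, S.xiIotaAI ι (x + 𝐞 ι)))
    (hI : ∀ N ≤ 1, IsTRS (fun x => ∑ ι, S.psiAI N ι (x + 𝐞 ι)))
    (hPi : IsTRS (fun x => ∑ ι, ∑ κ, S.piA ι κ (x + 𝐞 ι + 𝐞 κ)))
    (hN1 : 0 ≤ BetaMap.betaCPhiLow d i.mu i.xiAlphaOneMinusZeroAtZero i.xiIotaAlphaIAtEi)
    (hN2 : i.xiAbs + i.xiIotaAbs < 1) (hN3 : (BetaMap.nobleBetaOfInputs d i).βΨ < 1)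
    (hN4 : 0 ≤ (BetaMap.nobleBetaOfInputs d i).αFlow)
    (hcap : i.mu ≤ 7 / 10) (hcapP : i.piAlphaLower ≤ 1 / 8) (hcapQ : (2 * d - 1) * i.mub ≤ 2 * d * i.mu) :
    NobleSimplifiedFormF3At d p (BetaMap.nobleBetaOfInputsCorr d i)
      (NobleBetaF3.ofFn (BetaMap.extraOfInputsCorr d i)) :=
  nobleSimplifiedFormF3At_of_assumptions₆ hd hp hp0 hWF hE h41 h43 hTRS hI hPi hN1 hN2 hN3 hN4 hcap hcapP
    (nobleFRem_l1_le_extraOfInputs hd hp hp0 hWF h43 (isTRS_nobleFAlpha h41 hI hPi) hcapQ).2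
    (nobleFRem_weighted hd hp hp0 hWF h43 (isTRS_nobleFAlpha h41 hI hPi))

/-- **Percolation instance** of `nobleSimplifiedFormF3At_of_assumptions₈` (`S := percolationNobleSplit d p`): the
remaining inputs are the NoBLE equation, Assumption 4.3 with constants `i`, the decidable sign conditions and the
three caps — Assumption 4.1 and the three rotational symmetries are theorems for percolation.
[cite: FitznerVanDerHofstad2016NoBLE, Prop. 4.5 (p. 1088), App. D (pp. 1110–1117); FitznerVanDerHofstad2017, §3.5] -/
theorem nobleSimplifiedFormF3At_percolation₈ (hp0 : 0 < (p : ℝ)) (hWF : NobleInputsWF d i)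
    (hE : PercolationNobleEquationAt d p) (h43 : NobleAssumption43At d p (percolationNobleSplit d p hd hp) i)
    (hN1 : 0 ≤ BetaMap.betaCPhiLow d i.mu i.xiAlphaOneMinusZeroAtZero i.xiIotaAlphaIAtEi)
    (hN2 : i.xiAbs + i.xiIotaAbs < 1) (hN3 : (BetaMap.nobleBetaOfInputs d i).βΨ < 1)
    (hN4 : 0 ≤ (BetaMap.nobleBetaOfInputs d i).αFlow)
    (hcap : i.mu ≤ 7 / 10) (hcapP : i.piAlphaLower ≤ 1 / 8) (hcapQ : (2 * d - 1) * i.mub ≤ 2 * d * i.mu) :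
    NobleSimplifiedFormF3At d p (BetaMap.nobleBetaOfInputsCorr d i)
      (NobleBetaF3.ofFn (BetaMap.extraOfInputsCorr d i)) :=
  nobleSimplifiedFormF3At_of_assumptions₈ hd hp hp0 hWF hE (nobleAssumption41At_percolation hd p hp) h43
    (percolationNobleSplit_xiIotaAI_shift_trs hd hp) (fun N _ => percolationNobleSplit_psiAI_shift_trs hd hp N)
    (percolationNobleSplit_piA_shift_trs hd hp) hN1 hN2 hN3 hN4 hcap hcapP hcapQ

end AppDAssembly

end Literature.Probability.FitznerVanDerHofstad2017
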